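import Summits.QuantumFields.YangMills.Theorems.UnitScaleTiltProp7CombFrameRem2RecursionT3
import Summits.QuantumFields.YangMills.Theorems.UnitScaleTiltProp7CombAccFrameMassOfRegPrT3
import Summits.QuantumFields.YangMills.Theorems.UnitScaleTiltProp7FrameRem2Induction
import HarnessLib

/-!
# Route `UnitScaleTilt`, crux K1 «MinimiserStabilityRegPr» (stmt-QuantumFields-19200), route-R E′ (A′)-on-Σ, P-A2 (β), R0 ∕ REM2ᶜ — file F-γᶜ3 «REM2ᶜ AT THE TOP OF THE TOWER, ABSTRACT-ℓ FORM»: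
# **`Σ_{y : Site (F.P n) 0} ‖w_{iX}(y) − 1 − ℓ (K−n) (coordT3 y)‖ ≤ 2L·(477L²·Am + 3L·A_D + 49·220L³·Am)·ℓ⁻¹ + (477L²·Bm + 3L·B_D + 49·110L²·Bm)·ℓ`**, `ℓ = L^{K−n}` — the comb
# accumulated frame `w_{iX} = frameTw W (iX)` of the (β) door at second order, UNDER THE TWO ADMITTED ROUTE-INTERNAL ROWS: `hMcomb` (SIGNATURE-0 2f7f2fca, TOKEN FOR TOKEN at `A := iX`)
# and the «(n3)-comb₂» profile `hDs` of the displayed link remainders `hD` (the `hMcomb₂` shape, SIGNATURE-0′ 53b55878) — the COMB twin of ✓px13 `Prop7FrameRem2TopT3.frameRem2_top_T3`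

Cell `ym3-torus` (HUMAN RULING D-0037: YM₃ on the torus is ladder rung R3 — not d = 4, not a mass gap, not Clay), width seat `ym3-torus-px17` (gen 4); ★★OWNER RULINGS №19 (3) ∕ №20 (1)
((R0) ⟸ Φᶜ + Φˢ + REM2ˢ + REM2ᶜ ✓px13 `Prop7R0OfFrameRows`; REM2ᶜ ⟸ `hMcomb₂`).  `--supports stmt-QuantumFields-19200 --as helper`; THEOREMS ONLY (0 `def`, 0 `sorry`); count-neutral.
«route-internal rows (n3)-comb ∕ (n3)-comb₂ — NOT N06, NOT print rows; OPEN, XL∕L, LOCATE #54∕#57∕#58; RULINGS №19 O4 ∕ №20 (1)».  Nothing of `hMcomb`, `hMcomb₂`, (β), `hPA2`, `hcoS`, E′, EX, the crux,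
d = 4 or the gap is claimed.

THE ROWS (all in ✓`Prop7CombFrameRem2RecursionT3.combFrameRem2_recursion_of_regPr`'s letters): its binders VERBATIM (`hε₀`, `hε : 10⁷L⁴ε₀ ≤ 1`, `W`, `hreg`, `X`, `hX`, `hX6 : nMax19 < ε₀∕6`, abstract `ℓ ℓY` with
the displayed recursion `hℓ` and link-remainder row `hD`); `hℓ0 : ℓ 0 = 0` (the level-0 frames are `1`); `hMcomb` (the single-bar `ℓ²` level masses of print's comb tower, `l < K − n`, in the pull
letters of SIGNATURE-0 at `A := fun b ↦ I•X b`); `hDs : Σ_xΣ_κ D l l x κ ≤ A_D(Lˡ)⁻¹ + B_D·Lˡ` (`l ≤ K − n`).  The frame-mass profile `Φᶜ_l ≤ 220L³·Am·(Lˡ)⁻¹ + 110L²·Bm·Lˡ` is NOT displayed: it is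
★routeR-w6 ✓`Prop7CombAccFrameMassOfRegPr.combFrameMass_recursion_of_regPr` ∘ ✓`frameMass_induction` under `hMcomb` (as inside ✓`sum_normSq_frameTw_sub_one_le_of_hMcomb`).  The identification
`ℓ := fderiv` (★routeR-w2 ✓p702200 `fderiv_coe_vcov_succ_apply` ∘ (3ᶜ) tree-ratio derivative `= tsum` ∘ (2ᶜ) differentiability at `RegPr` ∘ ✓`fderiv_frameTw_eq_fderiv_vcov`) that turns the
conclusion into ✓`Prop7R0OfFrameRows.siteRow_of_frameRows`'s summed `hrc` row is F-γᶜ3b.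

WHAT IS PROVED (ns `…Theorems.Prop7CombFrameRem2TopT3`): `sum_norm_vcov_zero_sub_one_sub_eq_zero` (`Ψᶜ_0 = 0`), ★★ `combFrameMass_levels_of_hMcomb` (the frame-mass profile at EVERY level
`l ≤ K − n` under `hMcomb` — ✓p701781's induction, exported per level), ★★★ `combFrameRem2_top_of_hMcomb` (the title: F-γᶜ2 ∘ ✓p702558 `frameRem2_induction` at `c_B = 477L²`, `c_D = 3L`, `c_Φ = 49`,
re-indexed onto the comparison lattice along `siteShift` ∕ ✓`frameTw_eq_vcov`).
HONEST SCOPE.  Bookkeeping; the analytic content of REM2ᶜ is the displayed `hMcomb` + `hDs`∕`hD`; nothing of print asserted; rung R3, not Clay; YM gap NOT proved.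

References: T. Bałaban, CMP **98** (1985) 17–51 [Balaban1985Averaging] ((82) p.30, (97) p.32, Prop. 3 (122)–(126) p.36, (159)–(163) p.42); CMP **99** (1985) 75–102 [Balaban1985RegularSpaces]
(Prop. 7 p.100); CMP **102** (1985) 277–309 [Balaban1985Variational] ((19) p.281, (44) p.285); CMP **109** (1987) 249–301 [Balaban1987RG1] ((0.3)–(0.4) pp.252–253).
-/

set_option autoImplicit false

noncomputable section

open scoped BigOperators Matrix.Norms.L2Operator

namespace Summit.QuantumFields.YangMills.Theorems.Prop7CombFrameRem2TopT3

open Finset NormedSpace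
open Literature.MathematicalPhysics.QuantumFieldTheory.Balaban1983to89
open Literature.MathematicalPhysics.QuantumFieldTheory.Balaban1983to89.T3ContinuumYM3Torus
open T4Continuum BlockAveraging
open T3PrintedRegularMinimiser (RegPr)
open T3SectALandauChart (eta eta_pos bgUnits)
open T3LevelShift (siteShift)
open T3PrintedRegularOrbits (sites_eq)
open B7Prop1Explicit renaming Site → LSite
open B7Prop1Explicit (hol treeWord boxVec expUnit)
open B7Prop2Explicit (avgIter)
open B7Prop3Flat (expCfg)
open B7Eq92Concrete (tildIter vcov vcov_zero)
open B7Prop3GeneralRotated renaming tsum → covTsum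
open B10Eq27TorusAxialLog (pull pull_apply transl)
open Summit.QuantumFields.YangMills.Theorems.Prop7SPrint (basePt)
open Summit.QuantumFields.YangMills.Theorems.Prop7TPrint (nMax19)
open Summit.QuantumFields.YangMills.Theorems.Prop7SymAvgTw (coordT3 frameTw)
open Summit.QuantumFields.YangMills.Theorems.Prop7SymAvgTwFrameDiff (frameTw_eq_vcov pull_expUnit_eq_expCfg)
open Summit.QuantumFields.YangMills.Theorems.Prop7CombTowerRowsOfRegPr (member_windows)
open Summit.QuantumFields.YangMills.Theorems.Prop7TwistedLevelMassInduction (frameMass_induction)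
open Summit.QuantumFields.YangMills.Theorems.Prop7CombAccFrameMassOfRegPr (combFrameMass_recursion_of_regPr)
open Summit.QuantumFields.YangMills.Theorems.Prop7CombFrameRem2RecursionT3 (combFrameRem2_recursion_of_regPr)
open Summit.QuantumFields.YangMills.Theorems.Prop7FrameRem2Induction (frameRem2_induction)

section Member

variable (F : T3Family) {n K : ℕ} (h : n ≤ K)

/-- `Ψᶜ_0 = 0`: at level `0` print's accumulated frames are `v_0 = 1` (lit ✓`vcov_zero`), so with the zero linear part every second-order remainder vanishes. [cite: Balaban1985Averaging, (97) p.32] -/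
theorem sum_norm_vcov_zero_sub_one_sub_eq_zero (U₀ U₁ : LSite (F.P K).d → Fin (F.P K).d → (Matrix (Fin 2) (Fin 2) ℂ)ˣ)
    (ℓ : ℕ → LSite (F.P K).d → Matrix (Fin 2) (Fin 2) ℂ) (hℓ0 : ∀ x, ℓ 0 x = 0) :
    ∑ x : Site (F.P K) 0, ‖((vcov (F.P K).L U₀ U₁ 0 (fun μ => ((x μ).val : ℤ)) : (Matrix (Fin 2) (Fin 2) ℂ)ˣ) : Matrix (Fin 2) (Fin 2) ℂ) - 1 - ℓ 0 (fun μ => ((x μ).val : ℤ))‖ = 0 := by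
  refine Finset.sum_eq_zero fun x _ => ?_
  rw [hℓ0, vcov_zero]
  simp

/-- ★★ **THE COMB ACCUMULATED-FRAME MASSES AT EVERY LEVEL UNDER `hMcomb`**: for `l ≤ K − n`, `Φᶜ_l := Σ_x ‖v_l(x̂) − 1‖² ≤ 220L³·Am·(Lˡ)⁻¹ + 110L²·Bm·Lˡ` — ★routeR-w6
✓`combFrameMass_recursion_of_regPr` ∘ ✓`frameMass_induction`, the per-level form of ✓`sum_normSq_frameTw_sub_one_le_of_hMcomb`'s induction. [cite: Balaban1985Averaging, (97) p.32, (159)-(163) p.42; Balaban1987RG1, (0.3)-(0.4) pp.252-253] -/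
theorem combFrameMass_levels_of_hMcomb {ε₀ : ℝ} (hε₀ : 0 < ε₀) (hε : 10 ^ 7 * (F.L : ℝ) ^ 4 * ε₀ ≤ 1)
    (W : GaugeField (F.P K) 0 (Matrix.specialUnitaryGroup (Fin 2) ℂ)) (hreg : RegPr F n K ε₀ W)
    (X : PBond (F.P K) 0 → Matrix (Fin 2) (Fin 2) ℂ) (hX : ∀ b, (X b).IsHermitian ∧ (X b).trace = 0) (hX6 : nMax19 F n K W X < ε₀ / 6)
    {Am Bm : ℝ} (hAm : 0 ≤ Am) (hBm : 0 ≤ Bm)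
    (hMcomb : ∀ l : ℕ, l < K - n →
      ∑ z : Site (F.P K) l, ∑ κ : Fin (F.P K).d,
        ‖((tildIter (F.P K).L (pull (bgUnits F K W) (basePt F n K)) (pull (fun b => expUnit (Complex.I • X b)) (basePt F n K)) l
              (fun μ => ((z μ).val : ℤ)) κ : (Matrix (Fin 2) (Fin 2) ℂ)ˣ) : Matrix (Fin 2) (Fin 2) ℂ) - 1‖ ^ 2
          ≤ Am * ((F.L : ℝ) ^ l)⁻¹ + Bm * (F.L : ℝ) ^ l) :
    ∀ l ≤ K - n, ∑ x : Site (F.P K) l, ‖((vcov (F.P K).L (pull (bgUnits F K W) (basePt F n K)) (expCfg fun z κ => Complex.I • X ⟨transl (basePt F n K) z, κ⟩) l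
          (fun μ => ((x μ).val : ℤ)) : (Matrix (Fin 2) (Fin 2) ℂ)ˣ) : Matrix (Fin 2) (Fin 2) ℂ) - 1‖ ^ 2
        ≤ 220 * (F.L : ℝ) ^ 3 * Am * ((F.L : ℝ) ^ l)⁻¹ + 110 * (F.L : ℝ) ^ 2 * Bm * (F.L : ℝ) ^ l := by
  letI : CStarAlgebra (Matrix (Fin 2) (Fin 2) ℂ) := B10Eq29TubeLine.cstarAlgebraMatrix 2
  have hL3 : (3 : ℝ) ≤ F.L := by
    have h3 : 3 ≤ F.L := by obtain ⟨a, ha⟩ := F.hL.1; have := F.hL.2; omega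
    exact_mod_cast h3
  obtain ⟨-, -, -, hw4, -⟩ := member_windows F hε₀.le hε
  set U₀' := pull (bgUnits F K W) (basePt F n K) with hU₀'
  set B' : LSite (F.P K).d → Fin (F.P K).d → Matrix (Fin 2) (Fin 2) ℂ := fun z κ => Complex.I • X ⟨transl (basePt F n K) z, κ⟩ with hB'
  have hpull : pull (fun b => expUnit (Complex.I • X b)) (basePt F n K) = expCfg B' := pull_expUnit_eq_expCfg F (fun b => Complex.I • X b) (basePt F n K)
  set Φ : ℕ → ℝ := fun l => ∑ x : Site (F.P K) l, ‖((vcov (F.P K).L U₀' (expCfg B') l (fun μ => ((x μ).val : ℤ)) : (Matrix (Fin 2) (Fin 2) ℂ)ˣ) : Matrix (Fin 2) (Fin 2) ℂ) - 1‖ ^ 2 with hΦ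
  set M : ℕ → ℝ := fun l => if l < K - n then ∑ x : Site (F.P K) l, ∑ κ : Fin (F.P K).d,
    ‖((tildIter (F.P K).L U₀' (expCfg B') l (fun μ => ((x μ).val : ℤ)) κ : (Matrix (Fin 2) (Fin 2) ℂ)ˣ) : Matrix (Fin 2) (Fin 2) ℂ) - 1‖ ^ 2 else 0 with hM
  set q : ℝ := 3 * (((F.L : ℝ) ^ 3)⁻¹ + 144 * (780 * (F.L : ℝ) ^ 3 * ε₀ + 3 * (32 * ε₀)) ^ 2) with hq
  have hq0 : 0 ≤ q := by rw [hq]; positivity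
  have hΦ0 : Φ 0 = 0 := by
    rw [hΦ]; dsimp only
    refine Finset.sum_eq_zero fun x _ => ?_
    rw [vcov_zero, Units.val_one, sub_self, norm_zero]; ring
  have hΦs : ∀ l < K - n, Φ (l + 1) ≤ q * Φ l + 110 * (F.L : ℝ) ^ 2 * M l := by
    intro l hl
    have h := combFrameMass_recursion_of_regPr F hε₀ hε W hreg X hX hX6 hl
    rw [hM]; dsimp only; rw [if_pos hl]
    exact h
  have hMle : ∀ l ≤ K - n, M l ≤ Am * 1 * ((F.L : ℝ) ^ l)⁻¹ + Bm * (F.L : ℝ) ^ l := by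
    intro l hl
    rw [hM]; dsimp only
    by_cases hlt : l < K - n
    · rw [if_pos hlt, mul_one]
      have h := hMcomb l hlt
      rw [hpull] at h
      exact h
    · rw [if_neg hlt]; positivity
  intro l hl
  have hind := frameMass_induction (L := (F.L : ℝ)) (q := q) (C := 110 * (F.L : ℝ) ^ 2) (A := Am) (B := Bm) (M₀ := 1) (by linarith) hq0
    (by rw [hq]; exact hw4) (by positivity) hAm hBm zero_le_one (K - n) Φ M hΦ0 hΦs hMle l hl
  refine hind.trans (le_of_eq ?_); ring

/-- ★★★ **REM2ᶜ AT THE TOP, ABSTRACT-ℓ FORM**: under ✓`combFrameRem2_recursion_of_regPr`'s binders (incl. the displayed `hℓ`, `hD`), `ℓ 0 = 0`, the admitted row `hMcomb` (SIGNATURE-0 at `A := iX`) and the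
«(n3)-comb₂» profile `hDs` of the `hD`-majorants, all constants `≥ 0`:
`Σ_{y : Site (F.P n) 0} ‖↑(frameTw F n K h W (iX) y) − 1 − ℓ (K−n) (coordT3 y)‖ ≤ 2L·(477L²·Am + 3L·A_D + 49·(220L³·Am))·(L^{K−n})⁻¹ + (477L²·Bm + 3L·B_D + 49·(110L²·Bm))·L^{K−n}`.
[cite: Balaban1985Averaging, (82) p.30, (97) p.32, Prop. 3 (122)-(126) p.36; Balaban1985Variational, (44) p.285; Balaban1987RG1, (0.3)-(0.4) pp.252-253] -/
theorem combFrameRem2_top_of_hMcomb {ε₀ : ℝ} (hε₀ : 0 < ε₀) (hε : 10 ^ 7 * (F.L : ℝ) ^ 4 * ε₀ ≤ 1)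
    (W : GaugeField (F.P K) 0 (Matrix.specialUnitaryGroup (Fin 2) ℂ)) (hreg : RegPr F n K ε₀ W)
    (X : PBond (F.P K) 0 → Matrix (Fin 2) (Fin 2) ℂ) (hX : ∀ b, (X b).IsHermitian ∧ (X b).trace = 0) (hX6 : nMax19 F n K W X < ε₀ / 6)
    (ℓ : ℕ → LSite (F.P K).d → Matrix (Fin 2) (Fin 2) ℂ) (ℓY : ℕ → LSite (F.P K).d → Fin (F.P K).d → Matrix (Fin 2) (Fin 2) ℂ) (hℓ0 : ∀ x, ℓ 0 x = 0)
    (hℓ : ∀ l : ℕ, l < K - n → ∀ z : Site (F.P K) (l + 1),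
      ℓ (l + 1) (fun μ => ((z μ).val : ℤ))
        = ((Fintype.card (Fin (F.P K).d → Fin (F.P K).L) : ℂ))⁻¹ • ∑ r : Fin (F.P K).d → Fin (F.P K).L,
            (covTsum (avgIter (F.P K).L (pull (bgUnits F K W) (basePt F n K)) l) (ℓY l) (((F.P K).L : ℤ) • (fun μ => ((z μ).val : ℤ))) (treeWord (boxVec (F.P K).L r))
              + ((hol (avgIter (F.P K).L (pull (bgUnits F K W) (basePt F n K)) l) (((F.P K).L : ℤ) • (fun μ => ((z μ).val : ℤ))) (treeWord (boxVec (F.P K).L r)) :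
                    (Matrix (Fin 2) (Fin 2) ℂ)ˣ) : Matrix (Fin 2) (Fin 2) ℂ)
                * ℓ l (((F.P K).L : ℤ) • (fun μ => ((z μ).val : ℤ)) + boxVec (F.P K).L r)
                * (((hol (avgIter (F.P K).L (pull (bgUnits F K W) (basePt F n K)) l) (((F.P K).L : ℤ) • (fun μ => ((z μ).val : ℤ))) (treeWord (boxVec (F.P K).L r)))⁻¹ :
                    (Matrix (Fin 2) (Fin 2) ℂ)ˣ) : Matrix (Fin 2) (Fin 2) ℂ)))
    (D : ℕ → (l : ℕ) → Site (F.P K) l → Fin (F.P K).d → ℝ) (hD0 : ∀ l' l x κ, 0 ≤ D l' l x κ)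
    (hD : ∀ l : ℕ, l < K - n → ∀ (x : Site (F.P K) l) (κ : Fin (F.P K).d),
      ‖((tildIter (F.P K).L (pull (bgUnits F K W) (basePt F n K)) (expCfg fun z κ => Complex.I • X ⟨transl (basePt F n K) z, κ⟩) l (fun μ => ((x μ).val : ℤ)) κ :
            (Matrix (Fin 2) (Fin 2) ℂ)ˣ) : Matrix (Fin 2) (Fin 2) ℂ) - 1 - ℓY l (fun μ => ((x μ).val : ℤ)) κ‖ ≤ D l l x κ)
    {Am Bm AD BD : ℝ} (hAm : 0 ≤ Am) (hBm : 0 ≤ Bm) (hAD : 0 ≤ AD) (hBD : 0 ≤ BD)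
    (hMcomb : ∀ l : ℕ, l < K - n →
      ∑ z : Site (F.P K) l, ∑ κ : Fin (F.P K).d,
        ‖((tildIter (F.P K).L (pull (bgUnits F K W) (basePt F n K)) (pull (fun b => expUnit (Complex.I • X b)) (basePt F n K)) l
              (fun μ => ((z μ).val : ℤ)) κ : (Matrix (Fin 2) (Fin 2) ℂ)ˣ) : Matrix (Fin 2) (Fin 2) ℂ) - 1‖ ^ 2
          ≤ Am * ((F.L : ℝ) ^ l)⁻¹ + Bm * (F.L : ℝ) ^ l)
    (hDs : ∀ l ≤ K - n, ∑ x : Site (F.P K) l, ∑ κ : Fin (F.P K).d, D l l x κ ≤ AD * ((F.L : ℝ) ^ l)⁻¹ + BD * (F.L : ℝ) ^ l) :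
    ∑ y : Site (F.P n) 0, ‖((frameTw F n K h W (fun b => Complex.I • X b) y : (Matrix (Fin 2) (Fin 2) ℂ)ˣ) : Matrix (Fin 2) (Fin 2) ℂ) - 1 - ℓ (K - n) (coordT3 F n K h y)‖
      ≤ 2 * (F.L : ℝ) * (477 * (F.L : ℝ) ^ 2 * Am + 3 * (F.L : ℝ) * AD + 49 * (220 * (F.L : ℝ) ^ 3 * Am)) * ((F.L : ℝ) ^ (K - n))⁻¹
        + (477 * (F.L : ℝ) ^ 2 * Bm + 3 * (F.L : ℝ) * BD + 49 * (110 * (F.L : ℝ) ^ 2 * Bm)) * (F.L : ℝ) ^ (K - n) := by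
  letI : CStarAlgebra (Matrix (Fin 2) (Fin 2) ℂ) := B10Eq29TubeLine.cstarAlgebraMatrix 2
  have hL3 : (3 : ℝ) ≤ F.L := by
    have h3 : 3 ≤ F.L := by obtain ⟨a, ha⟩ := F.hL.1; have := F.hL.2; omega
    exact_mod_cast h3
  have hL2 : (2 : ℝ) ≤ F.L := by linarith
  have hL0 : (0 : ℝ) < F.L := by linarith
  set U₀' := pull (bgUnits F K W) (basePt F n K) with hU₀'
  set B' : LSite (F.P K).d → Fin (F.P K).d → Matrix (Fin 2) (Fin 2) ℂ := fun z κ => Complex.I • X ⟨transl (basePt F n K) z, κ⟩ with hB'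
  have hpull : pull (fun b => expUnit (Complex.I • X b)) (basePt F n K) = expCfg B' := pull_expUnit_eq_expCfg F (fun b => Complex.I • X b) (basePt F n K)
  -- the four level towers
  set Ψ : ℕ → ℝ := fun l => ∑ x : Site (F.P K) l, ‖((vcov (F.P K).L U₀' (expCfg B') l (fun μ => ((x μ).val : ℤ)) : (Matrix (Fin 2) (Fin 2) ℂ)ˣ) : Matrix (Fin 2) (Fin 2) ℂ) - 1
    - ℓ l (fun μ => ((x μ).val : ℤ))‖ with hΨ
  set M : ℕ → ℝ := fun l => if l < K - n then ∑ x : Site (F.P K) l, ∑ κ : Fin (F.P K).d,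
    ‖((tildIter (F.P K).L U₀' (expCfg B') l (fun μ => ((x μ).val : ℤ)) κ : (Matrix (Fin 2) (Fin 2) ℂ)ˣ) : Matrix (Fin 2) (Fin 2) ℂ) - 1‖ ^ 2 else 0 with hM
  set Dl : ℕ → ℝ := fun l => ∑ x : Site (F.P K) l, ∑ κ : Fin (F.P K).d, D l l x κ with hDl
  set Φ : ℕ → ℝ := fun l => ∑ x : Site (F.P K) l, ‖((vcov (F.P K).L U₀' (expCfg B') l (fun μ => ((x μ).val : ℤ)) : (Matrix (Fin 2) (Fin 2) ℂ)ˣ) : Matrix (Fin 2) (Fin 2) ℂ) - 1‖ ^ 2 with hΦ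
  have hΨ0 : Ψ 0 = 0 := sum_norm_vcov_zero_sub_one_sub_eq_zero F U₀' (expCfg B') ℓ hℓ0
  have hΨs : ∀ l < K - n, Ψ (l + 1) ≤ ((F.L : ℝ) ^ 3)⁻¹ * Ψ l + (477 * (F.L : ℝ) ^ 2 * M l + 3 * (F.L : ℝ) * Dl l + 49 * Φ l) := by
    intro l hl
    have h := combFrameRem2_recursion_of_regPr F hε₀ hε W hreg X hX hX6 ℓ ℓY hℓ D hD0 hD hl
    rw [hM]; dsimp only; rw [if_pos hl]
    linarith [h]
  have hMle : ∀ l ≤ K - n, M l ≤ Am * ((F.L : ℝ) ^ l)⁻¹ + Bm * (F.L : ℝ) ^ l := by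
    intro l hl
    rw [hM]; dsimp only
    by_cases hlt : l < K - n
    · rw [if_pos hlt]
      have h := hMcomb l hlt
      rw [hpull] at h
      exact h
    · rw [if_neg hlt]; positivity
  have hΦle : ∀ l ≤ K - n, Φ l ≤ 220 * (F.L : ℝ) ^ 3 * Am * ((F.L : ℝ) ^ l)⁻¹ + 110 * (F.L : ℝ) ^ 2 * Bm * (F.L : ℝ) ^ l :=
    combFrameMass_levels_of_hMcomb F hε₀ hε W hreg X hX hX6 hAm hBm hMcomb
  have hind := frameRem2_induction (L := (F.L : ℝ)) (cB := 477 * (F.L : ℝ) ^ 2) (cD := 3 * (F.L : ℝ)) (cΦ := 49)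
    (AM := Am) (BM := Bm) (AD := AD) (BD := BD) (AΦ := 220 * (F.L : ℝ) ^ 3 * Am) (BΦ := 110 * (F.L : ℝ) ^ 2 * Bm) hL2
    (by positivity) (by positivity) (by norm_num) hAm hBm hAD hBD (by positivity) (by positivity) (K - n) Ψ M Dl Φ hΨ0 hΨs hMle hDs hΦle (K - n) le_rfl
  -- the top: `frameTw = vcov` re-indexed along `siteShift`
  have htop : ∑ y : Site (F.P n) 0, ‖((frameTw F n K h W (fun b => Complex.I • X b) y : (Matrix (Fin 2) (Fin 2) ℂ)ˣ) : Matrix (Fin 2) (Fin 2) ℂ) - 1 - ℓ (K - n) (coordT3 F n K h y)‖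
      = Ψ (K - n) := by
    rw [hΨ]; dsimp only
    refine Fintype.sum_equiv (siteShift (sites_eq F n K h)) _ _ fun y => ?_
    rw [frameTw_eq_vcov]
    rfl
  rw [htop]
  exact hind

end Member

end Summit.QuantumFields.YangMills.Theorems.Prop7CombFrameRem2TopT3

end
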